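import Summits.NavierStokesRegularity.NavierStokesRegularity.Theorems.NavierStokesExistenceSmoothPeriodic
import Summits.NavierStokesRegularity.NavierStokesRegularity.Theorems.NavierStokesBreakdownPeriodic
import HarnessLib

/-!
# Clay (B) and (D) on `ℝ³/ℤ³`: the printed statements versus the CMI-errata reading

Conjecture/notion split (coordinator 2026-08-15) of `Literature/Analysis/FluidPDE/NSWave0.lean`:
that file keeps the VOCABULARY of Fefferman's Clay problem description (`NSWave0.IsDivFree`,
`IsNavierStokesSolution`, `IsSmoothOnHalfSpace`, `HasRapidTimeDecay`, `IsLatticePeriodic`, …);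
the Millennium statements (B), (C), (D) themselves are OPEN CONJECTURES — obligations of our
theories, not literature facts — canonical at the conjecture leaves
`Summit.NavierStokesRegularity.NavierStokesRegularity.NavierStokesExistenceSmoothPeriodic`,
`…NavierStokesBreakdownR3`, `…NavierStokesBreakdownPeriodic`
(`Summits/NavierStokesRegularity/NavierStokesRegularity/Theorems/`), leaves that contain nothing but
the `@[conjecture]` defs and that Literature may therefore import (CONVENTIONS §4).  This file
carries the two declarations of `NSWave0.lean` that MENTION the periodic conjectures, restated
verbatim over the canonical leaves:

* `NavierStokesExistenceSmoothPeriodic.of_pressurePeriodic` — the CMI-errata reading of (B)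
  (solutions with `u(·,t)` AND `p(·,t)` periodic) implies the printed (B);
* `NavierStokesBreakdownPeriodic.pressurePeriodic` — the printed (D) implies its CMI-errata
  reading (fewer candidate solutions to exclude).

Both are proved (one-line projections); no named fact is introduced.  (Declared in the path
namespace `Literature.Analysis.FluidPDE`; the hypotheses/conclusions are the `Summit.…` leaves, so
these are not dot-notation lemmas of the leaves.)

## References

* C. L. Fefferman, *Existence and smoothness of the Navier–Stokes equation*, Clay Mathematics
  Institute (2000/2006), statements (B), (D), conditions (8)–(11), and the errata page of the CMI
  offprint ("the further condition `p(x + eⱼ, t) = p(x, t)` should be made explicit").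
  [FeffermanClay2006]
-/

open scoped ContDiff

namespace Literature.Analysis.FluidPDE

noncomputable section

/-- The CMI-errata reading of Clay (B) — admissible solutions have both `u(·, t)` and `p(·, t)`
`ℤ³`-periodic for `t ≥ 0` ("the further condition `p(x + eⱼ, t) = p(x, t)` should be made
explicit", errata page of the CMI offprint) — implies the printed statement, the conjecture leaf
`Summit.NavierStokesRegularity.NavierStokesRegularity.NavierStokesExistenceSmoothPeriodic`.
[cite: FeffermanClay2006, statement (B) and errata] -/
theorem NavierStokesExistenceSmoothPeriodic.of_pressurePeriodic
    (h : ∀ ν : ℝ, 0 < ν → ∀ u₀ : EuclideanSpace ℝ (Fin 3) → EuclideanSpace ℝ (Fin 3), ContDiff ℝ ∞ u₀ → NSWave0.IsDivFree u₀ →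
      IsLatticePeriodic u₀ →
        ∃ (u : ℝ → EuclideanSpace ℝ (Fin 3) → EuclideanSpace ℝ (Fin 3)) (p : ℝ → EuclideanSpace ℝ (Fin 3) → ℝ),
          IsSmoothOnHalfSpace u ∧ IsSmoothOnHalfSpace p ∧
            IsNavierStokesSolution ν 0 u₀ u p ∧
              ∀ t, 0 ≤ t → IsLatticePeriodic (u t) ∧ IsLatticePeriodic (p t)) :
    Summit.NavierStokesRegularity.NavierStokesRegularity.NavierStokesExistenceSmoothPeriodic := by
  intro ν hν u₀ hsmooth hdiv hper
  obtain ⟨u, p, hu, hp, hsol, hperiodic⟩ := h ν hν u₀ hsmooth hdiv hper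
  exact ⟨u, p, hu, hp, hsol, fun t ht => (hperiodic t ht).1⟩

/-- The printed Clay (D) — the conjecture leaf
`Summit.NavierStokesRegularity.NavierStokesRegularity.NavierStokesBreakdownPeriodic` — implies its
CMI-errata reading: data as in (8), (9) for which NO smooth solution with both `u(·, t)` and
`p(·, t)` `ℤ³`-periodic for `t ≥ 0` exists ("the further condition `p(x + eⱼ, t) = p(x, t)`
should be made explicit", errata page of the CMI offprint) — fewer candidate solutions to
exclude. [cite: FeffermanClay2006, statement (D) and errata] -/
theorem NavierStokesBreakdownPeriodic.pressurePeriodic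
    (h : Summit.NavierStokesRegularity.NavierStokesRegularity.NavierStokesBreakdownPeriodic) :
    ∀ ν : ℝ, 0 < ν → ∃ (u₀ : EuclideanSpace ℝ (Fin 3) → EuclideanSpace ℝ (Fin 3)) (f : ℝ → EuclideanSpace ℝ (Fin 3) → EuclideanSpace ℝ (Fin 3)),
      ContDiff ℝ ∞ u₀ ∧ NSWave0.IsDivFree u₀ ∧ IsLatticePeriodic u₀ ∧
      IsSmoothOnHalfSpace f ∧ (∀ t, 0 ≤ t → IsLatticePeriodic (f t)) ∧ HasRapidTimeDecay f ∧
        ¬ ∃ (u : ℝ → EuclideanSpace ℝ (Fin 3) → EuclideanSpace ℝ (Fin 3)) (p : ℝ → EuclideanSpace ℝ (Fin 3) → ℝ),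
          IsSmoothOnHalfSpace u ∧ IsSmoothOnHalfSpace p ∧
            IsNavierStokesSolution ν f u₀ u p ∧
              ∀ t, 0 ≤ t → IsLatticePeriodic (u t) ∧ IsLatticePeriodic (p t) := by
  intro ν hν
  obtain ⟨u₀, f, hsmooth, hdiv, hper, hf, hfper, hdecay, hno⟩ := h ν hν
  refine ⟨u₀, f, hsmooth, hdiv, hper, hf, hfper, hdecay, ?_⟩
  rintro ⟨u, p, hu, hp, hsol, hperiodic⟩
  exact hno ⟨u, p, hu, hp, hsol, fun t ht => (hperiodic t ht).1⟩

end

end Literature.Analysis.FluidPDE
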